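import Literature.Probability.FitznerVanDerHofstad2017.SrwIntegralLargeD
import Mathlib.Analysis.SpecialFunctions.Integrals.Basic
import HarnessLib

/-!
# The Hölder split of the SRW Taylor-remainder integrals `I_{j,M}(0;d)`

CITATION HEADER. Companion to `SrwRemainderLemmas.lean` (same reproduction: R. Fitzner,
R. van der Hofstad, *Generalized approach to the non-backtracking lace expansion*, PTRF **169**
(2017) 1041–1119 [NoBLE17], §5 — the simple-random-walk integrals `I_{n,l}` of (3.35) p. 1071;
*Mean-field behavior for nearest-neighbor percolation in `d > 10`*, EJP **22** (2017) no. 43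
[FvdH17], Thm 1.1). Nothing is quoted from either paper: the file proves ONE elementary
inequality about the tree's own objects `srwI`, `srwLaw`, `Chat`, `Dhat`, `P` — Hölder's
inequality on the finite measure `P_d = dk` on `[-π,π]^d` applied to `|D̂|^M · Ĉ^j`:

* `srwI_zero_le_holder` : for `1 ≤ j < n`, `2n+1 ≤ d`, `M'` even and `(n-j)·M' ≤ n·M`,
  `I_{j,M}(0;d) ≤ p_{M'}(0;d)^{1-j/n} · I_{n,0}(0;d)^{j/n}`,
  where `I_{j,M}(0;d) = srwI d j M 0 = ∫ D̂^M Ĉ^j dk/(2π)^d`, `p_{M'}(0;d) = srwLaw d M' 0`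
  (`= ∫ D̂^{M'} dk/(2π)^d`, tree `srwI_zero_eq_srwLaw`, `DimMono.srwI_zero_eq_integral_phi`) and
  `I_{n,0}(0;d) = ∫ Ĉⁿ dk/(2π)^d` (`2n+1 ≤ d` is the integrability of `Ĉⁿ`, Heydenreich–van der
  Hofstad Prop. 5.5, tree `integrable_Chat_pow`).
  Proof: `D̂^M Ĉ^j ≤ |D̂|^M Ĉ^j`; Hölder with exponents `p = n/(n-j)` on `|D̂|^M` and `q = n/j`
  on `Ĉ^j` (Mathlib `integral_mul_le_Lp_mul_Lq_of_nonneg`); `(Ĉ^j)^q = Ĉⁿ`;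
  `(|D̂|^M)^p = |D̂|^{Mp} ≤ |D̂|^{M'} = D̂^{M'}` because `|D̂| ≤ 1` and `M' ≤ Mp`.
* The two instances used downstream: `srwI_zero_le_cauchySchwarz` (`n = 2j`, `M' = 2M`:
  `I_{j,M}(0) ≤ p_{2M}(0)^{1/2} I_{2j,0}(0)^{1/2}`, `4j+1 ≤ d`) and `srwI_zero_le_holder_five`
  (`n = 5`, `11 ≤ d`).

All statements are [folklore] kernel facts (no cited hypothesis, no programme-internal input).

## References
* [NoBLE17] R. Fitzner, R. van der Hofstad, PTRF 169 (2017) 1041–1119, (3.35) p. 1071, §5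
  (bib key `FitznerVanDerHofstad2016NoBLE`).
* [FvdH17] R. Fitzner, R. van der Hofstad, EJP 22 (2017) no. 43, Thm 1.1.
* M. Heydenreich, R. van der Hofstad, *Progress in high-dimensional percolation and random graphs*
  (2017), Prop. 5.5 (bib key `HeydenreichVanDerHofstad2017`).
-/

noncomputable section

open MeasureTheory Real Finset

namespace Literature.Probability.FitznerVanDerHofstad2017

open Literature.Barriers.CriticalPhenomena
open Literature.Barriers.CriticalPhenomena.Slade2006Prop53 (P μI)
open Literature.Barriers.CriticalPhenomena.LongRangePhi4 (srwLaw srwLaw_nonneg)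

namespace SrwRemainder

variable {d : ℕ}

/-- Normalisation algebra: `(V a)^{1-r} (V b)^r / V = a^{1-r} b^r` for `V > 0`, `a, b ≥ 0`.
[folklore] -/
theorem mul_rpow_mul_rpow_div {V a b r : ℝ} (hV : 0 < V) (ha : 0 ≤ a) (hb : 0 ≤ b) :
    (V * a) ^ (1 - r) * (V * b) ^ r / V = a ^ (1 - r) * b ^ r := by
  rw [Real.mul_rpow hV.le ha, Real.mul_rpow hV.le hb, div_eq_iff hV.ne']
  have h1 : V ^ (1 - r) * V ^ r = V := by rw [← Real.rpow_add hV]; simp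
  calc V ^ (1 - r) * a ^ (1 - r) * (V ^ r * b ^ r)
      = a ^ (1 - r) * b ^ r * (V ^ (1 - r) * V ^ r) := by ring
    _ = a ^ (1 - r) * b ^ r * V := by rw [h1]

/-- `I_{n,0}(0;d) = ∫ Ĉⁿ dk/(2π)^d`. [folklore] -/
theorem srwI_zero_zero_eq (d n : ℕ) :
    srwI d n 0 0 = (∫ k, Chat d 1 k ^ n ∂P d) / (2 * π) ^ d := by
  simp only [srwI, pow_zero, DhatSym_zero, mul_one, one_mul]

/-- `∫ D̂^M dk = (2π)^d p_M(0;d)`. [folklore] -/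
theorem integral_Dhat_pow_eq (d M : ℕ) :
    ∫ k, Dhat d k ^ M ∂P d = (2 * π) ^ d * srwLaw d M 0 := by
  have hV : (0 : ℝ) < (2 * π) ^ d := by positivity
  have h := DimMono.srwI_zero_eq_integral_phi d 0 M
  simp only [DimMono.phi, pow_zero, mul_one, srwI_zero_eq_srwLaw] at h
  rw [h]; field_simp

/-- **Hölder split of `I_{j,M}(0;d)`.** For `1 ≤ j < n`, `2n+1 ≤ d`, `M'` even with
`(n-j)·M' ≤ n·M`:  `I_{j,M}(0;d) ≤ p_{M'}(0;d)^{1-j/n} · I_{n,0}(0;d)^{j/n}`. [folklore] -/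
theorem srwI_zero_le_holder {j n M M' : ℕ} (hj : 1 ≤ j) (hjn : j < n) (hd : 2 * n + 1 ≤ d)
    (hM' : Even M') (hMM' : (n - j) * M' ≤ n * M) :
    srwI d j M 0 ≤ srwLaw d M' 0 ^ (1 - (j : ℝ) / n) * srwI d n 0 0 ^ ((j : ℝ) / n) := by
  set r : ℝ := (j : ℝ) / n with hr
  have hV : (0 : ℝ) < (2 * π) ^ d := by positivity
  have hn0 : (0 : ℝ) < n := by exact_mod_cast (show 0 < n by omega)
  have hj0 : (0 : ℝ) < j := by exact_mod_cast (show 0 < j by omega)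
  have hjn' : (j : ℝ) < n := by exact_mod_cast hjn
  have hnj : (0 : ℝ) < n - j := by linarith
  -- the integrand of `I_{j,M}(0)` and integrability facts
  have e0 : srwI d j M 0 = (∫ k, Dhat d k ^ M * Chat d 1 k ^ j ∂P d) / (2 * π) ^ d := by
    simp only [srwI, DhatSym_zero, mul_one]
  have hF : Integrable (fun k => Dhat d k ^ M * Chat d 1 k ^ j) (P d) :=
    integrable_weight_mul_Chat_pow (by omega) ((continuous_Dhat d).measurable.pow_const M)
      fun k => by rw [abs_pow]; exact abs_Dhat_pow_le_one M k
  have hG : Integrable (fun k => |Dhat d k| ^ M * Chat d 1 k ^ j) (P d) :=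
    integrable_weight_mul_Chat_pow (by omega)
      ((continuous_Dhat d).measurable.abs.pow_const M)
      fun k => by rw [abs_pow, abs_abs]; exact abs_Dhat_pow_le_one M k
  have hCn : Integrable (fun k => Chat d 1 k ^ n) (P d) :=
    integrable_Chat_pow n hd zero_le_one le_rfl
  have hCj : Integrable (fun k => Chat d 1 k ^ j) (P d) :=
    integrable_Chat_pow j (by omega) zero_le_one le_rfl
  have hDM' : Integrable (fun k => Dhat d k ^ M') (P d) :=
    (integrable_const (1 : ℝ)).mono' ((continuous_Dhat d).pow M').aestronglyMeasurable
      (ae_of_all _ fun k => by rw [Real.norm_eq_abs, abs_pow]; exact abs_Dhat_pow_le_one M' k)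
  have hIn : ∫ k, Chat d 1 k ^ n ∂P d = (2 * π) ^ d * srwI d n 0 0 := by
    rw [srwI_zero_zero_eq]; field_simp
  -- Hölder with `p = n/(n-j)` on `|D̂|^M` and `q = n/j` on `Ĉ^j`
  have hpq : Real.HolderConjugate ((n : ℝ) / (n - j)) ((n : ℝ) / j) := by
    refine Real.holderConjugate_iff.2 ⟨(one_lt_div hnj).2 (by linarith), ?_⟩
    rw [inv_div, inv_div, ← add_div, div_eq_one_iff_eq hn0.ne']; ring
  have hpow : ∀ k : Fin d → ℝ, (Chat d 1 k ^ j) ^ ((n : ℝ) / j) = Chat d 1 k ^ n := by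
    intro k
    rw [← Real.rpow_natCast _ j, ← Real.rpow_mul (Chat_one_nonneg k),
      show ((j : ℕ) : ℝ) * ((n : ℝ) / j) = ((n : ℕ) : ℝ) by field_simp, Real.rpow_natCast]
  have hgL : MemLp (fun k => Chat d 1 k ^ j) (ENNReal.ofReal ((n : ℝ) / j)) (P d) := by
    have hp0 : ENNReal.ofReal ((n : ℝ) / j) ≠ 0 := by
      rw [Ne, ENNReal.ofReal_eq_zero, not_le]; positivity
    refine (integrable_norm_rpow_iff hCj.aestronglyMeasurable hp0 ENNReal.ofReal_ne_top).1 ?_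
    have hfun : (fun k => ‖Chat d 1 k ^ j‖ ^ (ENNReal.ofReal ((n : ℝ) / j)).toReal) =
        fun k => Chat d 1 k ^ n := by
      funext k
      rw [ENNReal.toReal_ofReal (by positivity),
        Real.norm_of_nonneg (pow_nonneg (Chat_one_nonneg k) j), hpow]
    rw [hfun]
    exact hCn
  have hfL : MemLp (fun k => |Dhat d k| ^ M) (ENNReal.ofReal ((n : ℝ) / (n - j))) (P d) :=
    MemLp.of_bound ((continuous_Dhat d).abs.pow M).aestronglyMeasurable 1
      (ae_of_all _ fun k => by
        rw [Real.norm_eq_abs, abs_pow, abs_abs]; exact abs_Dhat_pow_le_one M k)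
  have hH := integral_mul_le_Lp_mul_Lq_of_nonneg (μ := P d) hpq
    (f := fun k => |Dhat d k| ^ M) (g := fun k => Chat d 1 k ^ j)
    (ae_of_all _ fun k => pow_nonneg (abs_nonneg _) M)
    (ae_of_all _ fun k => pow_nonneg (Chat_one_nonneg k) j) hfL hgL
  -- the two factors
  have hintn : ∫ k, (Chat d 1 k ^ j) ^ ((n : ℝ) / j) ∂P d = ∫ k, Chat d 1 k ^ n ∂P d :=
    integral_congr_ae (ae_of_all _ fun k => hpow k)
  have hD1 : ∀ k : Fin d → ℝ, |Dhat d k| ≤ 1 := fun k => by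
    simpa only [pow_one] using abs_Dhat_pow_le_one 1 k
  have hgle : ∫ k, (|Dhat d k| ^ M) ^ ((n : ℝ) / (n - j)) ∂P d ≤ ∫ k, Dhat d k ^ M' ∂P d := by
    refine integral_mono_of_nonneg
      (ae_of_all _ fun k => Real.rpow_nonneg (pow_nonneg (abs_nonneg _) M) _) hDM'
      (ae_of_all _ fun k => ?_)
    have ht0 : 0 ≤ |Dhat d k| := abs_nonneg _
    have hexp : (M' : ℝ) ≤ (M : ℝ) * ((n : ℝ) / (n - j)) := by
      rw [← mul_div_assoc, le_div_iff₀ hnj]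
      have h' : ((n - j : ℕ) : ℝ) * M' ≤ (n : ℝ) * M := by exact_mod_cast hMM'
      rw [Nat.cast_sub hjn.le] at h'
      linarith
    show (|Dhat d k| ^ M) ^ ((n : ℝ) / (n - j)) ≤ Dhat d k ^ M'
    rw [← hM'.pow_abs, ← Real.rpow_natCast _ M, ← Real.rpow_mul ht0, ← Real.rpow_natCast _ M']
    exact Real.rpow_le_rpow_of_exponent_ge' ht0 (hD1 k) (by positivity) hexp
  have hexp1 : 1 / ((n : ℝ) / (n - j)) = 1 - r := by
    rw [hr, one_div_div, sub_div, div_self hn0.ne']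
  have hexp2 : 1 / ((n : ℝ) / j) = r := by rw [hr, one_div_div]
  rw [hintn, hexp1, hexp2] at hH
  -- assemble
  have hmain : ∫ k, Dhat d k ^ M * Chat d 1 k ^ j ∂P d ≤
      ((2 * π) ^ d * srwLaw d M' 0) ^ (1 - r) * ((2 * π) ^ d * srwI d n 0 0) ^ r := by
    calc ∫ k, Dhat d k ^ M * Chat d 1 k ^ j ∂P d
        ≤ ∫ k, |Dhat d k| ^ M * Chat d 1 k ^ j ∂P d := by
          refine integral_mono hF hG fun k => ?_
          exact mul_le_mul_of_nonneg_right
            (by rw [← abs_pow]; exact le_abs_self _) (pow_nonneg (Chat_one_nonneg k) j)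
      _ ≤ (∫ k, (|Dhat d k| ^ M) ^ ((n : ℝ) / (n - j)) ∂P d) ^ (1 - r) *
            (∫ k, Chat d 1 k ^ n ∂P d) ^ r := hH
      _ ≤ (∫ k, Dhat d k ^ M' ∂P d) ^ (1 - r) * (∫ k, Chat d 1 k ^ n ∂P d) ^ r := by
          have h1r : 0 ≤ 1 - r := by
            rw [hr, sub_nonneg, div_le_one hn0]; exact hjn'.le
          refine mul_le_mul_of_nonneg_right (Real.rpow_le_rpow ?_ hgle h1r)
            (Real.rpow_nonneg (integral_nonneg fun k => pow_nonneg (Chat_one_nonneg k) n) _)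
          exact integral_nonneg fun k => Real.rpow_nonneg (pow_nonneg (abs_nonneg _) M) _
      _ = ((2 * π) ^ d * srwLaw d M' 0) ^ (1 - r) * ((2 * π) ^ d * srwI d n 0 0) ^ r := by
          rw [integral_Dhat_pow_eq, hIn]
  have hInn : 0 ≤ srwI d n 0 0 := by
    rw [srwI_zero_zero_eq]
    exact div_nonneg (integral_nonneg fun k => pow_nonneg (Chat_one_nonneg k) n) hV.le
  have hpnn : 0 ≤ srwLaw d M' 0 := srwLaw_nonneg M' 0
  rw [e0, ← mul_rpow_mul_rpow_div hV hpnn hInn]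
  exact div_le_div_of_nonneg_right hmain hV.le

/-- **Cauchy–Schwarz instance** (`n = 2j`, `M' = 2M`): for `1 ≤ j`, `4j+1 ≤ d` and every `M`,
`I_{j,M}(0;d) ≤ p_{2M}(0;d)^{1/2} · I_{2j,0}(0;d)^{1/2}`. [folklore] -/
theorem srwI_zero_le_cauchySchwarz {j M : ℕ} (hj : 1 ≤ j) (hd : 4 * j + 1 ≤ d) :
    srwI d j M 0 ≤ srwLaw d (2 * M) 0 ^ ((1 : ℝ) / 2) * srwI d (2 * j) 0 0 ^ ((1 : ℝ) / 2) := by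
  have hj0 : (j : ℝ) ≠ 0 := by exact_mod_cast (show j ≠ 0 by omega)
  have hMM' : (2 * j - j) * (2 * M) ≤ 2 * j * M := by
    rw [show 2 * j - j = j by omega]; exact le_of_eq (by ring)
  have h := srwI_zero_le_holder (d := d) (j := j) (n := 2 * j) (M := M) (M' := 2 * M) hj
    (by omega) (by omega) (even_two_mul M) hMM'
  have h1 : 1 - (j : ℝ) / ((2 * j : ℕ) : ℝ) = 1 / 2 := by push_cast; field_simp; ring
  have h2 : (j : ℝ) / ((2 * j : ℕ) : ℝ) = 1 / 2 := by push_cast; field_simp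
  rw [h1, h2] at h
  exact h

/-- **Hölder instance with `Ĉ⁵`** (`n = 5`): for `1 ≤ j ≤ 4`, `11 ≤ d`, `M'` even with
`(5-j)·M' ≤ 5·M`, `I_{j,M}(0;d) ≤ p_{M'}(0;d)^{1-j/5} · I_{5,0}(0;d)^{j/5}`. [folklore] -/
theorem srwI_zero_le_holder_five {j M M' : ℕ} (hj : 1 ≤ j) (hj4 : j ≤ 4) (hd : 11 ≤ d)
    (hM' : Even M') (hMM' : (5 - j) * M' ≤ 5 * M) :
    srwI d j M 0 ≤ srwLaw d M' 0 ^ (1 - (j : ℝ) / 5) * srwI d 5 0 0 ^ ((j : ℝ) / 5) := by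
  have h := srwI_zero_le_holder (d := d) (j := j) (n := 5) (M := M) (M' := M') hj
    (by omega) (by omega) hM' hMM'
  exact_mod_cast h

end SrwRemainder

end Literature.Probability.FitznerVanDerHofstad2017
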